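import Summits.ResolutionOfSingularities.ResolutionOfSingularities.Theorems.HilbertSamuelEliminationSigmaMaxModificationsCorridor3WLadderMovingRows
import HarnessLib

/-!
# [OURS · L1 W4.2] The THIRD-DOOR socket of the W-low-char row, RE-CUT to what the assembly consumes:
# `IsoLowDirDimTerminatesQM p` — (F1)-regime origins, grade `ē ≤ 2` chains only (crux chain w42, line `w_ladder` v5b/v6)

OURS (cell res-hironaka, slot W4.2, LEAD PROVER res-L1-w42-lead-1 gen 3); NOT statements of H. Hironaka's manuscript
[Hironaka2017] nor of [CossartJannsenSaito2020]; AI proving/typing, weaker than expert review.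
`--supports stmt-ResolutionOfSingularities-19249`.

FINDING (lead-1, 2026-08-27). The module's third-door socket `Moving.IsoLowDirDimTerminatesM p` (`…Corridor3WLadderMovingDefs`,
§3a; consumed ONLY by `Moving.wlow3CharUnitsM_of_extraction` / `wlowUnitsM_of_extraction`) is typed for EVERY maximal origin (no
regime cut) and forbids moving chains of EVERY grade (`fun _ => True`) from an in-scope stage that is isolated in the Hilbert–Samuel
locus with `e ≤ 1`. Its only printed doors are CJS Thm. 3.14 (near points on `ℙ(Dir_x/T_xD)`, standing assumption (F1):
`char κ(x) = 0 ∨ char κ(x) ≥ dim X/2 + 1`) and Cor. 6.37 (printed under (F1)): outside (F1) — `p = 2`, `dim X = 3` — a stage with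
`e_x = 1 < ē_x = 3` is the γ-TOP cell of CHAIN v3.8 (T-c) (Hironaka's quadric, tree barrier `DirectrixSmallCharacteristic`: directrix
zero yet a near point), where NO printed theorem confines near points; so `IsoLowDirDimTerminatesM 2` contains W-top-γ content and is
NOT closable modulo print. But the consumer applies the socket only to (i) origins in the (F1) regime `QCharRegime p` and (ii) the
TAIL of a grade-`ē ≤ 2` chain. THE RE-CUT SOCKET `IsoLowDirDimTerminatesQM p` keeps exactly (i)+(ii); the assembly goes through
VERBATIM (`wlow3CharUnitsM_of_extractionQ`, `wlow3CharM_assembledQ`, PROVED), and the old socket implies the new one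
(`isoLowDirDimTerminatesQM_of_M`, PROVED). Doors of the re-cut socket: Thm. 3.14 in the (F1) range (tree named fact
`CossartJannsenSaito2020_thm_3_14`, p499700) for `e = 0` (no near point over a blown-up isolated point) and Cor. 6.37 (tree named fact
`Corollary637_char`) for `e = 1`, through the finite-segment bridge of CHAIN v3.8 (B-2)/(B-4); at `p = 2` the twin socket with
`¬ QCharRegime` is served by 2.14♯ (ruling v3.8-D: `ē − dim D ≤ 2 ≤ 2p − 2` on grade-`≤ 2` chains).

## References

* V. Cossart, U. Jannsen, S. Saito, LNM 2270 (2020), Thm. 3.14, Cor. 6.37, Thm. 6.40, Rem. 18.29, Ex. 18.30. [CossartJannsenSaito2020]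
-/

noncomputable section

set_option linter.dupNamespace false -- mandated namespace of this single-conjunct summit

open CategoryTheory AlgebraicGeometry TopologicalSpace
open Summit.ResolutionOfSingularities.ResolutionOfSingularities.Theorems.CampaignW42
open Literature.AlgebraicGeometry.Resolution Literature.RingTheory.HilbertSamuel
open Literature.AlgebraicGeometry.CossartJannsenSaito2020
open Summit.ResolutionOfSingularities.ResolutionOfSingularities.Theses.HilbertSamuelElimination
open Summit.ResolutionOfSingularities.ResolutionOfSingularities.Theorems.SigmaMaxModificationsCorridor3

namespace Summit.ResolutionOfSingularities.ResolutionOfSingularities.Theorems.SigmaMaxModificationsCorridor3.Moving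

open Summit.ResolutionOfSingularities.ResolutionOfSingularities.Theorems.SigmaMaxModificationsCorridor3.Helpers

/-- [OURS · L1 W4.2] **THIRD-DOOR SOCKET, RE-CUT**: in the (F1) regime `QCharRegime p`, from a stage REACHED from a maximal origin
at level `3` that is ISOLATED in the Hilbert–Samuel locus with `e ≤ 1`, there is no infinite MOVING chain of grade `ē ≤ 2` (CJS Thm. 3.14
for `e = 0`, Cor. 6.37 for `e = 1`, both under (F1)). The assembly `wlow3CharUnitsM_of_extraction` consumes only this. OURS; NOT a
statement of [CossartJannsenSaito2020]. [cite: CossartJannsenSaito2020, Cor. 6.37, Thm. 3.14] -/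
def IsoLowDirDimTerminatesQM (p : ℕ) : Prop :=
  ∀ (R : ∀ S : Scheme.{0}, CentreSeq S → Prop), OracleFunctional R → OracleAdmissible R →
  ∀ (ν : ℕ → ℕ) (X : Scheme.{0}) [IsLocallyNoetherian X] (x : X), IsMaximalOrigin p 3 ν X x → QCharRegime p 3 ν X x →
  ∀ s : MarkedStage.{0}, Reaches R 3 ν (MarkedStage.init X x) s → Iso 3 s → dirDim s ≤ 1 →
    NoMovingNearChainFrom R 3 ν s fun t => t.geomDirDim ≤ 2

/-- The module's socket implies the re-cut one (so nothing proved for `IsoLowDirDimTerminatesM` is lost). [folklore] -/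
theorem isoLowDirDimTerminatesQM_of_M {p : ℕ} (h : IsoLowDirDimTerminatesM p) : IsoLowDirDimTerminatesQM p := by
  intro R hRf hRa ν X _ x hX _ s hs hiso hdir
  rintro ⟨c, h0, hstep, -, hmov⟩
  exact h R hRf hRa ν s ⟨X, ‹_›, x, hX, hs⟩ hiso hdir ⟨c, h0, hstep, fun _ => trivial, hmov⟩

/-- **PROVED REDUCTION (re-cut): the UNITS-half of `Wlow3CharM`** from F-key `KeyTheorem640_char_isolated` + the RE-CUT third-door
socket + the (F1)-regime extraction — the proof of `wlow3CharUnitsM_of_extraction` verbatim (the socket is applied to an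
(F1)-origin and to the tail of a grade-`≤ 2` chain). [cite: CossartJannsenSaito2020, Thm. 6.40, Cor. 6.37] -/
theorem wlow3CharUnitsM_of_extractionQ {p : ℕ} (hK : KeyTheorem640_char_isolated.{0})
    (hlow : IsoLowDirDimTerminatesQM p) (hext : UnitTowerExtractionQM p) : Wlow3CharUnitsM p := by
  intro R hRf hRa ν X _ x hX hq
  rintro ⟨c, h0, hstep, hG, hmov, hrec⟩
  by_cases hlowstage : ∃ m, Iso 3 (c m) ∧ dirDim (c m) ≤ 1
  · obtain ⟨m, hiso, hdir⟩ := hlowstage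
    exact hlow R hRf hRa ν X x hX hq (c m) (reaches_chain h0 hstep m) hiso hdir
      ⟨fun n => c (m + n), Relation.ReflTransGen.refl, fun n => hstep (m + n), fun n => hG (m + n), io_shift hmov m⟩
  · push Not at hlowstage
    have he : ∀ n, Iso 3 (c n) → dirDim (c n) = 2 ∧ (c n).geomDirDim = 2 := by
      intro n hiso
      have h1 := hlowstage n hiso
      have h2 := dirDim_le_geomDirDim (c n)
      have h3 := hG n
      exact ⟨by omega, by omega⟩
    obtain ⟨T, len, pt, hset, hchar, hchain, hisoT⟩ := hext R hRf hRa ν X x hX hq c h0 hstep hG hmov hrec he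
    exact hK T 3 len pt hset hchar hchain hisoT

/-- **`Wlow3CharM` assembled through the RE-CUT socket (PROVED reduction)**: F-key `KeyTheorem640_char_isolated` +
`IsoLowDirDimTerminatesQM` + `UnitTowerExtractionQM` + `Wlow3CharStrataM`. [cite: CossartJannsenSaito2020, Thm. 6.40, Cor. 6.37, Thm. 6.35] -/
theorem wlow3CharM_assembledQ {p : ℕ} (hK : KeyTheorem640_char_isolated.{0}) (hlow : IsoLowDirDimTerminatesQM p)
    (hext : UnitTowerExtractionQM p) (hS : Wlow3CharStrataM p) : Wlow3CharM.{0} p :=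
  wlow3CharM_of_units_strata (wlow3CharUnitsM_of_extractionQ hK hlow hext) hS

end Summit.ResolutionOfSingularities.ResolutionOfSingularities.Theorems.SigmaMaxModificationsCorridor3.Moving

end
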